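import Summits.Ventures.PercRepro.S1CoreLPCells

/-!
# PercRepro — THE COLOOP COUNT UNDER THE `e`-FREE FLAT BOUNDS, AND THE INSTANCES (p2, gen 29; SUBCLAIM-S1
§6.10 (xviii)(i))

The coloop count of `S1CoreLPTools` with the remaining flat bounds of the `e`-free core: under «lines ≤ 3, planes
≤ 6» a set of nullity `≥ 4` has rank `≥ 4` after its coloops are removed, so at most `ρ(S) − 4` coloops; with
«rank-`4` sets ≤ 10 points» nullity `≥ 7` gives `≤ ρ(S) − 5`; with the local-sparse bound `|X| + 1 ≤ 2^{ρ(X)}`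
nullity `≥ 27` gives `≤ ρ(S) − 6`. The upward and closure instances follow as in `S1CoreLPCells`. For the cells
`(7, d ≥ 10)` and `(8, d ≥ 10)` of the window. Nothing is claimed about any cell.

* `exists_eRk_sdiff_coloops`, `ncard_coloops_add_four_le_eRk_of_planes`, `ncard_coloops_add_five_le_eRk_of_tens`,
  `ncard_coloops_add_six_le_eRk_of_sparse`; `up_instance_planes`, `cl_instance_planes`, `up_instance_tens`,
  `cl_instance_tens`, `up_instance_sparse`, `cl_instance_sparse`; `ncard_extensions_add_le_of_flat`, `ext_planes`, `ext_tens`, `ext_sparse`, `ncard_U_add_le_ten`, `cl_instance_lines_planes`, `cl_instance_lines_tens`, `cl_instance_planes_tens`; `rkSets_eq_empty_of_planes`,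
  `rkSets_eq_empty_of_tens`, `rkSets_eq_empty_of_sparse`.
Axioms: standard.
-/

open scoped Matroid

namespace PercRepro

namespace S1

open Set

variable {α : Type} {M : Matroid α} [M.Finite]

/-- The common core: the coloops `C` of a dependent set and the rank / size of `S ∖ C`. -/
theorem exists_eRk_sdiff_coloops (hpairs : ∀ e ∈ M.E, ∀ f ∈ M.E, e ≠ f → M.eRk {e, f} = 2)
    (hE2 : 2 ≤ M.E.ncard) {S : Set α} (hS : S ⊆ M.E) {r : ℕ} (hr : M.eRk S = (r : ℕ∞))
    (hdep : r + 1 ≤ S.ncard) :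
    ∃ a : ℕ, M.eRk (S \ {x ∈ S | M.eRk (S \ {x}) + 1 = M.eRk S}) = (a : ℕ∞) ∧
      a + {x ∈ S | M.eRk (S \ {x}) + 1 = M.eRk S}.ncard = r ∧
      (S \ {x ∈ S | M.eRk (S \ {x}) + 1 = M.eRk S}).ncard + {x ∈ S | M.eRk (S \ {x}) + 1 = M.eRk S}.ncard = S.ncard ∧
      2 ≤ a := by
  set C := {x ∈ S | M.eRk (S \ {x}) + 1 = M.eRk S} with hCdef
  have hSfin : S.Finite := M.ground_finite.subset hS
  have hCS : C ⊆ S := fun x hx => hx.1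
  have hCfin : C.Finite := hSfin.subset hCS
  have hout : ∀ x ∈ C, x ∈ M.E ∧ x ∉ M.closure (S \ {x}) := by
    intro x hx
    refine ⟨hS hx.1, fun hmem => ?_⟩
    have hsub : S ⊆ M.closure (S \ {x}) := by
      intro y hy
      by_cases hyx : y = x
      · rw [hyx]; exact hmem
      · exact M.subset_closure (S \ {x}) (sdiff_subset.trans hS) ⟨hy, hyx⟩
    have h1 : M.eRk S ≤ M.eRk (S \ {x}) := by
      calc M.eRk S ≤ M.eRk (M.closure (S \ {x})) := M.eRk_mono hsub
        _ = M.eRk (S \ {x}) := M.eRk_closure_eq _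
    have h2 := hx.2
    have hle : M.eRk (S \ {x}) ≤ (r : ℕ∞) := by rw [← hr]; exact M.eRk_mono sdiff_subset
    have hfin : M.eRk (S \ {x}) ≠ ⊤ := ne_top_of_le_ne_top (ENat.coe_ne_top r) hle
    obtain ⟨a, ha⟩ := ENat.ne_top_iff_exists.mp hfin
    rw [← ha] at h1 h2
    rw [← h2] at h1
    have : a + 1 ≤ a := by exact_mod_cast h1
    omega
  have hA := eRk_sdiff_add_encard_of_forall_notMem_closure (M := M) hCS hCfin hout
  rw [hr] at hA
  have hsize : (S \ C).encard + C.encard = S.encard := encard_sdiff_add_encard_of_subset hCS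
  have hfinD : M.eRk (S \ C) ≠ ⊤ := ne_top_of_le_ne_top (ENat.coe_ne_top r) (by rw [← hA]; exact le_self_add)
  obtain ⟨a, ha⟩ := ENat.ne_top_iff_exists.mp hfinD
  rw [← ha] at hA
  rw [← hCfin.cast_ncard_eq] at hA hsize
  rw [← hSfin.cast_ncard_eq, ← (hSfin.subset sdiff_subset).cast_ncard_eq] at hsize
  have hA' : a + C.ncard = r := by exact_mod_cast hA
  have hsize' : (S \ C).ncard + C.ncard = S.ncard := by exact_mod_cast hsize
  have h2 := ncard_coloops_add_two_le_eRk hpairs hE2 hS hr hdep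
  rw [← hCdef] at h2
  exact ⟨a, ha.symm, hA', hsize', by omega⟩

/-- **THE COLOOP COUNT UNDER «LINES ≤ 3, PLANES ≤ 6»**: nullity `≥ 4` ⇒ at most `ρ(S) − 4` coloops. -/
theorem ncard_coloops_add_four_le_eRk_of_planes (hpairs : ∀ e ∈ M.E, ∀ f ∈ M.E, e ≠ f → M.eRk {e, f} = 2)
    (hlines : ∀ L ⊆ M.E, M.eRk L = 2 → L.ncard ≤ 3) (hplanes : ∀ P ⊆ M.E, M.eRk P ≤ 3 → P.ncard ≤ 6)
    (hE2 : 2 ≤ M.E.ncard) {S : Set α} (hS : S ⊆ M.E) {r : ℕ} (hr : M.eRk S = (r : ℕ∞))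
    (hdep : r + 4 ≤ S.ncard) : {x ∈ S | M.eRk (S \ {x}) + 1 = M.eRk S}.ncard + 4 ≤ r := by
  obtain ⟨a, ha, hA, hsize, h2⟩ := exists_eRk_sdiff_coloops hpairs hE2 hS hr (by omega)
  set C := {x ∈ S | M.eRk (S \ {x}) + 1 = M.eRk S} with hCdef
  by_contra hlt
  push Not at hlt
  have hsub : S \ C ⊆ M.E := sdiff_subset.trans hS
  rcases Nat.lt_or_ge a 3 with h | h
  · have ha2 : a = 2 := by omega
    have := hlines (S \ C) hsub (by rw [ha, ha2]; rfl)
    omega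
  · have ha3 : a = 3 := by omega
    have := hplanes (S \ C) hsub (by rw [ha, ha3]; exact le_refl _)
    omega

/-- **THE COLOOP COUNT UNDER «LINES ≤ 3, PLANES ≤ 6, RANK-4 SETS ≤ 10»**: nullity `≥ 7` ⇒ at most `ρ(S) − 5`
coloops. -/
theorem ncard_coloops_add_five_le_eRk_of_tens (hpairs : ∀ e ∈ M.E, ∀ f ∈ M.E, e ≠ f → M.eRk {e, f} = 2)
    (hlines : ∀ L ⊆ M.E, M.eRk L = 2 → L.ncard ≤ 3) (hplanes : ∀ P ⊆ M.E, M.eRk P ≤ 3 → P.ncard ≤ 6)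
    (htens : ∀ X ⊆ M.E, M.eRk X ≤ 4 → X.ncard ≤ 10)
    (hE2 : 2 ≤ M.E.ncard) {S : Set α} (hS : S ⊆ M.E) {r : ℕ} (hr : M.eRk S = (r : ℕ∞))
    (hdep : r + 7 ≤ S.ncard) : {x ∈ S | M.eRk (S \ {x}) + 1 = M.eRk S}.ncard + 5 ≤ r := by
  obtain ⟨a, ha, hA, hsize, h2⟩ := exists_eRk_sdiff_coloops hpairs hE2 hS hr (by omega)
  set C := {x ∈ S | M.eRk (S \ {x}) + 1 = M.eRk S} with hCdef
  have h4 := ncard_coloops_add_four_le_eRk_of_planes hpairs hlines hplanes hE2 hS hr (by omega)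
  rw [← hCdef] at h4
  by_contra hlt
  push Not at hlt
  have ha4 : a = 4 := by omega
  have := htens (S \ C) (sdiff_subset.trans hS) (by rw [ha, ha4]; exact le_refl _)
  omega

/-- **THE COLOOP COUNT UNDER THE LOCAL-SPARSE BOUND** `|X| + 1 ≤ 2^{ρ(X)}` (with the three small bounds): nullity
`≥ 27` ⇒ at most `ρ(S) − 6` coloops. -/
theorem ncard_coloops_add_six_le_eRk_of_sparse (hpairs : ∀ e ∈ M.E, ∀ f ∈ M.E, e ≠ f → M.eRk {e, f} = 2)
    (hlines : ∀ L ⊆ M.E, M.eRk L = 2 → L.ncard ≤ 3) (hplanes : ∀ P ⊆ M.E, M.eRk P ≤ 3 → P.ncard ≤ 6)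
    (htens : ∀ X ⊆ M.E, M.eRk X ≤ 4 → X.ncard ≤ 10) (hsparse : ∀ X ⊆ M.E, M.eRk X ≤ 5 → X.ncard ≤ 31)
    (hE2 : 2 ≤ M.E.ncard) {S : Set α} (hS : S ⊆ M.E) {r : ℕ} (hr : M.eRk S = (r : ℕ∞))
    (hdep : r + 27 ≤ S.ncard) : {x ∈ S | M.eRk (S \ {x}) + 1 = M.eRk S}.ncard + 6 ≤ r := by
  obtain ⟨a, ha, hA, hsize, h2⟩ := exists_eRk_sdiff_coloops hpairs hE2 hS hr (by omega)
  set C := {x ∈ S | M.eRk (S \ {x}) + 1 = M.eRk S} with hCdef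
  have h5 := ncard_coloops_add_five_le_eRk_of_tens hpairs hlines hplanes htens hE2 hS hr (by omega)
  rw [← hCdef] at h5
  by_contra hlt
  push Not at hlt
  have ha5 : a = 5 := by omega
  have := hsparse (S \ C) (sdiff_subset.trans hS) (by rw [ha, ha5]; exact le_refl _)
  omega

section Instances

/-- **THE UPWARD INSTANCE UNDER «PLANES ≤ 6»**: for `b + 4 ≤ k`, `c = b − 3`. -/
theorem up_instance_planes (hpairs : ∀ e ∈ M.E, ∀ f ∈ M.E, e ≠ f → M.eRk {e, f} = 2)
    (hlines : ∀ L ⊆ M.E, M.eRk L = 2 → L.ncard ≤ 3) (hplanes : ∀ P ⊆ M.E, M.eRk P ≤ 3 → P.ncard ≤ 6)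
    (hE2 : 2 ≤ M.E.ncard) (k b : ℕ) (hkb : b + 4 ≤ k) :
    (M.E.ncard - k) * (rkSets M k b).ncard ≤
      (b - 3) * (rkSets M (k + 1) (b + 1)).ncard + (k + 1) * (rkSets M (k + 1) b).ncard := by
  apply up_incidence k b (b - 3)
  intro S hS hSk hSb
  rw [setOf_eRk_sdiff_eq_of_eRk_succ hSb]
  have := ncard_coloops_add_four_le_eRk_of_planes hpairs hlines hplanes hE2 hS hSb (by omega)
  omega

/-- **THE CLOSURE INSTANCE UNDER «PLANES ≤ 6»**: for `b + 3 ≤ k`, `b < p`, `ms = k − b + 5`. -/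
theorem cl_instance_planes {p : ℕ} (hM : M.eRank = (p : ℕ∞)) (hcol : M.coloops = ∅)
    (hpairs : ∀ e ∈ M.E, ∀ f ∈ M.E, e ≠ f → M.eRk {e, f} = 2)
    (hlines : ∀ L ⊆ M.E, M.eRk L = 2 → L.ncard ≤ 3) (hplanes : ∀ P ⊆ M.E, M.eRk P ≤ 3 → P.ncard ≤ 6)
    (hE2 : 2 ≤ M.E.ncard) (k b : ℕ) (hbk : b + 3 ≤ k) (hbp : b < p) :
    (k - b + 5) * (rkSets M (k + 1) b).ncard ≤ (M.E.ncard - (p - b + 1) - k) * (rkSets M k b).ncard := by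
  apply closure_incidence k b (k - b + 5) (M.E.ncard - (p - b + 1) - k)
  · intro S hS hSk hSb
    have h1 := ncard_le_ncard_setOf_eRk_sdiff_eq hS hSb
    have h2 := ncard_coloops_add_four_le_eRk_of_planes hpairs hlines hplanes hE2 hS hSb (by omega)
    omega
  · intro A hA hAk hAb
    have := ncard_extensions_add_le_of_coloops hM hcol hA hAb hbp
    omega

/-- **THE UPWARD INSTANCE UNDER «RANK-4 SETS ≤ 10»**: for `b + 7 ≤ k`, `c = b − 4`. -/
theorem up_instance_tens (hpairs : ∀ e ∈ M.E, ∀ f ∈ M.E, e ≠ f → M.eRk {e, f} = 2)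
    (hlines : ∀ L ⊆ M.E, M.eRk L = 2 → L.ncard ≤ 3) (hplanes : ∀ P ⊆ M.E, M.eRk P ≤ 3 → P.ncard ≤ 6)
    (htens : ∀ X ⊆ M.E, M.eRk X ≤ 4 → X.ncard ≤ 10)
    (hE2 : 2 ≤ M.E.ncard) (k b : ℕ) (hkb : b + 7 ≤ k) :
    (M.E.ncard - k) * (rkSets M k b).ncard ≤
      (b - 4) * (rkSets M (k + 1) (b + 1)).ncard + (k + 1) * (rkSets M (k + 1) b).ncard := by
  apply up_incidence k b (b - 4)
  intro S hS hSk hSb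
  rw [setOf_eRk_sdiff_eq_of_eRk_succ hSb]
  have := ncard_coloops_add_five_le_eRk_of_tens hpairs hlines hplanes htens hE2 hS hSb (by omega)
  omega

/-- **THE CLOSURE INSTANCE UNDER «RANK-4 SETS ≤ 10»**: for `b + 6 ≤ k`, `b < p`, `ms = k − b + 6`. -/
theorem cl_instance_tens {p : ℕ} (hM : M.eRank = (p : ℕ∞)) (hcol : M.coloops = ∅)
    (hpairs : ∀ e ∈ M.E, ∀ f ∈ M.E, e ≠ f → M.eRk {e, f} = 2)
    (hlines : ∀ L ⊆ M.E, M.eRk L = 2 → L.ncard ≤ 3) (hplanes : ∀ P ⊆ M.E, M.eRk P ≤ 3 → P.ncard ≤ 6)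
    (htens : ∀ X ⊆ M.E, M.eRk X ≤ 4 → X.ncard ≤ 10)
    (hE2 : 2 ≤ M.E.ncard) (k b : ℕ) (hbk : b + 6 ≤ k) (hbp : b < p) :
    (k - b + 6) * (rkSets M (k + 1) b).ncard ≤ (M.E.ncard - (p - b + 1) - k) * (rkSets M k b).ncard := by
  apply closure_incidence k b (k - b + 6) (M.E.ncard - (p - b + 1) - k)
  · intro S hS hSk hSb
    have h1 := ncard_le_ncard_setOf_eRk_sdiff_eq hS hSb
    have h2 := ncard_coloops_add_five_le_eRk_of_tens hpairs hlines hplanes htens hE2 hS hSb (by omega)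
    omega
  · intro A hA hAk hAb
    have := ncard_extensions_add_le_of_coloops hM hcol hA hAb hbp
    omega

/-- **THE UPWARD INSTANCE UNDER THE LOCAL-SPARSE BOUND**: for `b + 27 ≤ k`, `c = b − 5`. -/
theorem up_instance_sparse (hpairs : ∀ e ∈ M.E, ∀ f ∈ M.E, e ≠ f → M.eRk {e, f} = 2)
    (hlines : ∀ L ⊆ M.E, M.eRk L = 2 → L.ncard ≤ 3) (hplanes : ∀ P ⊆ M.E, M.eRk P ≤ 3 → P.ncard ≤ 6)
    (htens : ∀ X ⊆ M.E, M.eRk X ≤ 4 → X.ncard ≤ 10) (hsparse : ∀ X ⊆ M.E, M.eRk X ≤ 5 → X.ncard ≤ 31)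
    (hE2 : 2 ≤ M.E.ncard) (k b : ℕ) (hkb : b + 27 ≤ k) :
    (M.E.ncard - k) * (rkSets M k b).ncard ≤
      (b - 5) * (rkSets M (k + 1) (b + 1)).ncard + (k + 1) * (rkSets M (k + 1) b).ncard := by
  apply up_incidence k b (b - 5)
  intro S hS hSk hSb
  rw [setOf_eRk_sdiff_eq_of_eRk_succ hSb]
  have := ncard_coloops_add_six_le_eRk_of_sparse hpairs hlines hplanes htens hsparse hE2 hS hSb (by omega)
  omega

/-- **THE CLOSURE INSTANCE UNDER THE LOCAL-SPARSE BOUND**: for `b + 26 ≤ k`, `b < p`, `ms = k − b + 7`. -/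
theorem cl_instance_sparse {p : ℕ} (hM : M.eRank = (p : ℕ∞)) (hcol : M.coloops = ∅)
    (hpairs : ∀ e ∈ M.E, ∀ f ∈ M.E, e ≠ f → M.eRk {e, f} = 2)
    (hlines : ∀ L ⊆ M.E, M.eRk L = 2 → L.ncard ≤ 3) (hplanes : ∀ P ⊆ M.E, M.eRk P ≤ 3 → P.ncard ≤ 6)
    (htens : ∀ X ⊆ M.E, M.eRk X ≤ 4 → X.ncard ≤ 10) (hsparse : ∀ X ⊆ M.E, M.eRk X ≤ 5 → X.ncard ≤ 31)
    (hE2 : 2 ≤ M.E.ncard) (k b : ℕ) (hbk : b + 26 ≤ k) (hbp : b < p) :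
    (k - b + 7) * (rkSets M (k + 1) b).ncard ≤ (M.E.ncard - (p - b + 1) - k) * (rkSets M k b).ncard := by
  apply closure_incidence k b (k - b + 7) (M.E.ncard - (p - b + 1) - k)
  · intro S hS hSk hSb
    have h1 := ncard_le_ncard_setOf_eRk_sdiff_eq hS hSb
    have h2 := ncard_coloops_add_six_le_eRk_of_sparse hpairs hlines hplanes htens hsparse hE2 hS hSb (by omega)
    omega
  · intro A hA hAk hAb
    have := ncard_extensions_add_le_of_coloops hM hcol hA hAb hbp
    omega

end Instances


section Zeros

omit [M.Finite] in
/-- No `k`-set with `k ≥ 7` has rank `≤ 3` under «planes ≤ 6». -/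
theorem rkSets_eq_empty_of_planes (hplanes : ∀ P ⊆ M.E, M.eRk P ≤ 3 → P.ncard ≤ 6) {k r : ℕ} (hr : r ≤ 3)
    (hk : 6 < k) : rkSets M k r = ∅ := by
  rw [eq_empty_iff_forall_notMem]
  rintro X ⟨hXE, hXk, hXr⟩
  have := hplanes X hXE (by rw [hXr]; exact_mod_cast hr)
  omega

omit [M.Finite] in
/-- No `k`-set with `k ≥ 11` has rank `≤ 4` under «rank-`4` sets ≤ 10». -/
theorem rkSets_eq_empty_of_tens (htens : ∀ X ⊆ M.E, M.eRk X ≤ 4 → X.ncard ≤ 10) {k r : ℕ} (hr : r ≤ 4)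
    (hk : 10 < k) : rkSets M k r = ∅ := by
  rw [eq_empty_iff_forall_notMem]
  rintro X ⟨hXE, hXk, hXr⟩
  have := htens X hXE (by rw [hXr]; exact_mod_cast hr)
  omega

omit [M.Finite] in
/-- No `k`-set with `k ≥ 32` has rank `≤ 5` under the local-sparse bound. -/
theorem rkSets_eq_empty_of_sparse (hsparse : ∀ X ⊆ M.E, M.eRk X ≤ 5 → X.ncard ≤ 31) {k r : ℕ} (hr : r ≤ 5)
    (hk : 31 < k) : rkSets M k r = ∅ := by
  rw [eq_empty_iff_forall_notMem]
  rintro X ⟨hXE, hXk, hXr⟩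
  have := hsparse X hXE (by rw [hXr]; exact_mod_cast hr)
  omega

end Zeros

section FlatExtensions

/-- **THE EXTENSION BOUND FROM A FLAT-SIZE BOUND**: if every set of rank `≤ b` has at most `F` points, a rank-`b`
set `B` has at most `F − |B|` extensions `B ∪ {x}` of rank `b`. -/
theorem ncard_extensions_add_le_of_flat {b F : ℕ} (hflat : ∀ X ⊆ M.E, M.eRk X ≤ (b : ℕ∞) → X.ncard ≤ F)
    {B : Set α} (hB : B ⊆ M.E) (hb : M.eRk B = (b : ℕ∞)) :
    {x ∈ M.E \ B | M.eRk (insert x B) = (b : ℕ∞)}.ncard + B.ncard ≤ F := by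
  set T := {x ∈ M.E \ B | M.eRk (insert x B) = (b : ℕ∞)} with hTdef
  have hTE : T ⊆ M.E := fun x hx => hx.1.1
  have hXE : B ∪ T ⊆ M.E := union_subset hB hTE
  have hdisj : Disjoint B T := by
    rw [Set.disjoint_left]
    intro x hxB hxT
    exact hxT.1.2 hxB
  have hsubcl : B ∪ T ⊆ M.closure B := by
    intro x hx
    rcases hx with hxB | hxT
    · exact M.subset_closure B hB hxB
    · by_contra hnot
      have h := M.eRk_insert_eq_add_one ⟨hxT.1.1, hnot⟩
      rw [hxT.2, hb] at h
      have h' : b = b + 1 := by exact_mod_cast h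
      omega
  have hrk : M.eRk (B ∪ T) ≤ (b : ℕ∞) := by
    calc M.eRk (B ∪ T) ≤ M.eRk (M.closure B) := M.eRk_mono hsubcl
      _ = (b : ℕ∞) := by rw [M.eRk_closure_eq, hb]
  have := hflat (B ∪ T) hXE hrk
  rw [ncard_union_eq hdisj (M.ground_finite.subset hB) (M.ground_finite.subset hTE)] at this
  omega

/-- The extension bound of a rank-`3` set under «planes ≤ 6». -/
theorem ext_planes (hplanes : ∀ P ⊆ M.E, M.eRk P ≤ 3 → P.ncard ≤ 6) {A : Set α} (hA : A ⊆ M.E)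
    (hAb : M.eRk A = ((3 : ℕ) : ℕ∞)) :
    {x ∈ M.E \ A | M.eRk (insert x A) = ((3 : ℕ) : ℕ∞)}.ncard + A.ncard ≤ 6 :=
  ncard_extensions_add_le_of_flat (b := 3) (F := 6) (fun X hX hr => hplanes X hX hr) hA hAb

/-- The extension bound of a rank-`4` set under «rank-`4` sets ≤ 10». -/
theorem ext_tens (htens : ∀ X ⊆ M.E, M.eRk X ≤ 4 → X.ncard ≤ 10) {A : Set α} (hA : A ⊆ M.E)
    (hAb : M.eRk A = ((4 : ℕ) : ℕ∞)) :
    {x ∈ M.E \ A | M.eRk (insert x A) = ((4 : ℕ) : ℕ∞)}.ncard + A.ncard ≤ 10 :=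
  ncard_extensions_add_le_of_flat (b := 4) (F := 10) (fun X hX hr => htens X hX hr) hA hAb

/-- The extension bound of a rank-`5` set under the local-sparse bound. -/
theorem ext_sparse (hsparse : ∀ X ⊆ M.E, M.eRk X ≤ 5 → X.ncard ≤ 31) {A : Set α} (hA : A ⊆ M.E)
    (hAb : M.eRk A = ((5 : ℕ) : ℕ∞)) :
    {x ∈ M.E \ A | M.eRk (insert x A) = ((5 : ℕ) : ℕ∞)}.ncard + A.ncard ≤ 31 :=
  ncard_extensions_add_le_of_flat (b := 5) (F := 31) (fun X hX hr => hsparse X hX hr) hA hAb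

/-- **THE `U`-BOUND WITH THE RANK-4 SETS CUT AT `10` POINTS**: for `d ≥ 10`,
`#U + #{(n−4)-sets of rank ≤ p − 1} ≤ C(n, 4) + Σ_{5 ≤ k ≤ 10} m[k, 4]`. -/
theorem ncard_U_add_le_ten {p n d : ℕ} (hM : M.eRank = (p : ℕ∞)) (hp : 1 ≤ p) (hn : M.E.ncard = n) (hn4 : 4 ≤ n)
    (hd : n = p + d) (hd10 : 10 ≤ d) (htens : ∀ X ⊆ M.E, M.eRk X ≤ 4 → X.ncard ≤ 10) :
    {A : Set α | A ⊆ M.E ∧ M.eRk A = (p : ℕ∞) ∧ M.eRk (M.E \ A) = ((4 : ℕ) : ℕ∞)}.ncard +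
      (lowRankSets M (n - 4) (p - 1)).ncard ≤
      Nat.choose n 4 + ∑ k ∈ Finset.Icc 5 10, (rkSets M k 4).ncard := by
  have h := ncard_U_add_le (M := M) hM hp hn hn4 hd
  have hsum : ∑ k ∈ Finset.Icc 5 d, (rkSets M k 4).ncard = ∑ k ∈ Finset.Icc 5 10, (rkSets M k 4).ncard := by
    symm
    apply Finset.sum_subset
    · intro k hk
      rw [Finset.mem_Icc] at hk ⊢
      omega
    · intro k hk hk'
      rw [Finset.mem_Icc] at hk hk'
      rw [rkSets_eq_empty_of_tens htens (by norm_num) (by omega)]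
      exact ncard_empty _
  rw [hsum] at h
  exact h

end FlatExtensions

section FlatInstances

/-- **THE CLOSURE INSTANCE AT `b = 3` UNDER «LINES ≤ 3, PLANES ≤ 6»**: for `4 ≤ k`, `(k + 1)·m[k+1,3] ≤ (6 − k)·m[k,3]`. -/
theorem cl_instance_lines_planes (hpairs : ∀ e ∈ M.E, ∀ f ∈ M.E, e ≠ f → M.eRk {e, f} = 2)
    (hlines : ∀ L ⊆ M.E, M.eRk L = 2 → L.ncard ≤ 3) (hplanes : ∀ P ⊆ M.E, M.eRk P ≤ 3 → P.ncard ≤ 6)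
    (hE2 : 2 ≤ M.E.ncard) (k : ℕ) (hk : 4 ≤ k) :
    (k + 1) * (rkSets M (k + 1) 3).ncard ≤ (6 - k) * (rkSets M k 3).ncard := by
  apply closure_incidence k 3 (k + 1) (6 - k)
  · intro S hS hSk hSb
    have h1 := ncard_le_ncard_setOf_eRk_sdiff_eq hS hSb
    have h2 := ncard_coloops_add_three_le_eRk_of_lines hpairs hlines hE2 hS hSb (by omega)
    omega
  · intro A hA hAk hAb
    have := ext_planes hplanes hA hAb
    omega

/-- **THE CLOSURE INSTANCE AT `b = 4` UNDER «LINES ≤ 3, RANK-4 SETS ≤ 10»**: for `5 ≤ k ≤ 6`,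
`k·m[k+1,4] ≤ (10 − k)·m[k,4]`. -/
theorem cl_instance_lines_tens (hpairs : ∀ e ∈ M.E, ∀ f ∈ M.E, e ≠ f → M.eRk {e, f} = 2)
    (hlines : ∀ L ⊆ M.E, M.eRk L = 2 → L.ncard ≤ 3) (htens : ∀ X ⊆ M.E, M.eRk X ≤ 4 → X.ncard ≤ 10)
    (hE2 : 2 ≤ M.E.ncard) (k : ℕ) (hk : 5 ≤ k) :
    k * (rkSets M (k + 1) 4).ncard ≤ (10 - k) * (rkSets M k 4).ncard := by
  apply closure_incidence k 4 k (10 - k)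
  · intro S hS hSk hSb
    have h1 := ncard_le_ncard_setOf_eRk_sdiff_eq hS hSb
    have h2 := ncard_coloops_add_three_le_eRk_of_lines hpairs hlines hE2 hS hSb (by omega)
    omega
  · intro A hA hAk hAb
    have := ext_tens htens hA hAb
    omega

/-- **THE CLOSURE INSTANCE AT `b = 4` UNDER «PLANES ≤ 6, RANK-4 SETS ≤ 10»**: for `7 ≤ k`,
`(k + 1)·m[k+1,4] ≤ (10 − k)·m[k,4]`. -/
theorem cl_instance_planes_tens (hpairs : ∀ e ∈ M.E, ∀ f ∈ M.E, e ≠ f → M.eRk {e, f} = 2)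
    (hlines : ∀ L ⊆ M.E, M.eRk L = 2 → L.ncard ≤ 3) (hplanes : ∀ P ⊆ M.E, M.eRk P ≤ 3 → P.ncard ≤ 6)
    (htens : ∀ X ⊆ M.E, M.eRk X ≤ 4 → X.ncard ≤ 10)
    (hE2 : 2 ≤ M.E.ncard) (k : ℕ) (hk : 7 ≤ k) :
    (k + 1) * (rkSets M (k + 1) 4).ncard ≤ (10 - k) * (rkSets M k 4).ncard := by
  apply closure_incidence k 4 (k + 1) (10 - k)
  · intro S hS hSk hSb
    have h1 := ncard_le_ncard_setOf_eRk_sdiff_eq hS hSb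
    have h2 := ncard_coloops_add_four_le_eRk_of_planes hpairs hlines hplanes hE2 hS hSb (by omega)
    omega
  · intro A hA hAk hAb
    have := ext_tens htens hA hAb
    omega

end FlatInstances

end S1

end PercRepro
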